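import Literature.MathematicalPhysics.QuantumLattice.WilsonDiracTimeSlices
import HarnessLib

/-!
# The Wilson–Dirac operator as a block matrix over time slices

In the time-slice indexing `timeIndex` of `WilsonDiracTimeSlices`, the `r = 1` Wilson–Dirac
operator in the Dirac-type spin basis is the block matrix `wilsonBlock a b d w` of
`WilsonBlockDeterminant`: diagonal blocks `[[a_t, b_t], [-b_tᴴ, a_t]]`, the temporal hopping
`-[[0,0],[0,w_t]]` at `(t, t+1)` and `-[[w_tᴴ,0],[0,0]]` at `(t+1, t)` — the projections
`½(1 ∓ γ'₀)` select the lower/upper spinor halves (`reindex_wilsonKron_eq_wilsonBlock`,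
`det_wilsonDirac_eq_det_wilsonBlock`). We also record the algebraic properties of the slice
blocks used by the transfer-matrix formula: `a_t = (m+1)·1 + ½ Σ_j (1-H_j)ᴴ(1-H_j) ⊗ 1₂` is
Hermitian and positive definite for `m > -1`, `-b_tᴴ` is the lower-left block, and
`w_t w_tᴴ = 1` for unitary link variables (Lüscher 1977 §3; Montvay–Münster (1994) §4.2.3).
-/

noncomputable section

-- The time-slice index types (`((κ × Fin 2) ⊕ (κ × Fin 2)) × Fin (n+1)` and the Gram indices built
-- from them) are too deep for the default instance-search size bound (`DecidableEq`, needed by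
-- `Matrix.det`).
set_option synthInstance.maxSize 512

namespace Literature.MathematicalPhysics.QuantumLattice

section SliceBlocks

open _root_.Matrix Literature.Probability.LatticeModels QuantumFieldTheory Literature.LinearAlgebra.Matrix
open scoped Kronecker ComplexOrder

variable {n N : ℕ} {G : Type*} [Group G] (ρ : G →* Matrix (Fin N) (Fin N) ℂ)

/-! ### The four block patterns -/

/-- Upper–upper entries of the Kronecker-form operator in the time-slice indexing. [folklore] -/
theorem wilsonKron_timeIndex_inl_inl (hρ : ∀ g, ρ g ∈ Matrix.unitaryGroup (Fin N) ℂ)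
    (U : GaugeConfig 4 (n + 1) G) (m : ℝ)
    (u u' : ((Fin 3 → ZMod (n + 1)) × Fin N) × Fin 2) (t s : Fin (n + 1)) :
    wilsonKron ρ diracGamma U m 1 (timeIndex n N (Sum.inl u, t)) (timeIndex n N (Sum.inl u', s)) =
      (if t = s then sliceDiag ρ U m t u u' else 0) - (if t = s + 1 then (sliceLink ρ U s)ᴴ u u' else 0) := by
  obtain ⟨⟨y, a⟩, h⟩ := u
  obtain ⟨⟨y', b⟩, h'⟩ := u'
  obtain ⟨h0m, h0p, hjm, hjp⟩ := diracGamma_uu h h'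
  rw [timeIndex_inl, timeIndex_inl, wilsonKron_apply, Fin.sum_univ_succ, sliceDiag_apply,
    sliceLink_conjTranspose_apply ρ hρ]
  have hca : (Fin.castAdd 2 h = Fin.castAdd 2 h') ↔ h = h' := (Fin.castAdd_injective _ _).eq_iff
  simp only [h0m, h0p, hjm, hjp, sliceSite_eq_shift_zero_iff, sliceSite_eq_shift_succ_iff, sliceSite_inj,
    hca, mul_zero, ite_self, zero_add, Complex.ofReal_one, one_smul, mul_one]
  by_cases hh : h = h'
  · subst hh
    simp only [↓reduceIte, mul_one, and_true]
    by_cases hts : t = s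
    · subst hts
      simp only [↓reduceIte, true_and, ite_and]
      split_ifs <;> ring
    · have hst : ¬ s = t := fun e => hts e.symm
      simp only [hts, hst, false_and, ↓reduceIte, add_zero, Finset.sum_const_zero, zero_sub, ite_and]
      split_ifs <;> ring
  · simp [hh]

omit [Group G] in
/-- Upper and lower spin indices are distinct. [folklore] -/
private theorem castAdd_ne_natAdd (h h' : Fin 2) : Fin.castAdd 2 h ≠ Fin.natAdd 2 h' := by
  intro e
  have := congrArg Fin.val e
  simp only [Fin.val_castAdd, Fin.val_natAdd] at this
  omega

/-- Upper–lower entries of the Kronecker-form operator in the time-slice indexing. [folklore] -/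
theorem wilsonKron_timeIndex_inl_inr (U : GaugeConfig 4 (n + 1) G) (m : ℝ)
    (u u' : ((Fin 3 → ZMod (n + 1)) × Fin N) × Fin 2) (t s : Fin (n + 1)) :
    wilsonKron ρ diracGamma U m 1 (timeIndex n N (Sum.inl u, t)) (timeIndex n N (Sum.inr u', s)) =
      if t = s then sliceOff ρ U t u u' else 0 := by
  obtain ⟨⟨y, a⟩, h⟩ := u
  obtain ⟨⟨y', b⟩, h'⟩ := u'
  obtain ⟨h0m, h0p, hjm, hjp⟩ := diracGamma_ul h h'
  rw [timeIndex_inl, timeIndex_inr, wilsonKron_apply, Fin.sum_univ_succ, sliceOff_apply]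
  simp only [h0m, h0p, hjm, hjp, sliceSite_eq_shift_zero_iff, sliceSite_eq_shift_succ_iff, sliceSite_inj,
    castAdd_ne_natAdd, mul_zero, ite_self, zero_add, Complex.ofReal_one, one_smul, and_false, ↓reduceIte,
    zero_sub]
  by_cases hts : t = s
  · subst hts
    simp only [true_and, ↓reduceIte, neg_mul_eq_mul_neg, ← Finset.sum_neg_distrib]
    congr 1
    refine Finset.sum_congr rfl fun j _ => ?_
    split_ifs <;> ring
  · have hst : ¬ s = t := fun e => hts e.symm
    simp [hts, hst]

/-- For a unitary representation the backward spatial hopping is the adjoint of the forward one. [folklore] -/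
theorem sliceHop_conjTranspose (hρ : ∀ g, ρ g ∈ Matrix.unitaryGroup (Fin N) ℂ)
    (U : GaugeConfig 4 (n + 1) G) (t : Fin (n + 1)) (j : Fin 3) :
    (sliceHop ρ U t j)ᴴ = sliceHop' ρ U t j := by
  ext ⟨y, a⟩ ⟨y', b⟩
  simp only [Matrix.conjTranspose_apply, sliceHop, sliceHop', Matrix.of_apply]
  by_cases hy : y = y' + Pi.single j 1
  · subst hy; simp [unitaryRep_star_apply ρ hρ]
  · simp [hy]

/-- ... and conversely. [folklore] -/
theorem sliceHop'_conjTranspose (hρ : ∀ g, ρ g ∈ Matrix.unitaryGroup (Fin N) ℂ)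
    (U : GaugeConfig 4 (n + 1) G) (t : Fin (n + 1)) (j : Fin 3) :
    (sliceHop' ρ U t j)ᴴ = sliceHop ρ U t j := by
  rw [← sliceHop_conjTranspose ρ hρ, Matrix.conjTranspose_conjTranspose]

/-- The lower–upper spatial block is `-b_tᴴ = ½ Σ_j (H_j - H'_j) ⊗ g_jᴴ`. [folklore] -/
theorem neg_sliceOff_conjTranspose (hρ : ∀ g, ρ g ∈ Matrix.unitaryGroup (Fin N) ℂ)
    (U : GaugeConfig 4 (n + 1) G) (t : Fin (n + 1)) :
    -(sliceOff ρ U t)ᴴ = (1 / 2 : ℂ) • ∑ j : Fin 3, ((sliceHop ρ U t j - sliceHop' ρ U t j) ⊗ₖ (diracBlock j)ᴴ) := by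
  rw [sliceOff, Matrix.conjTranspose_smul, Matrix.conjTranspose_sum]
  simp only [Matrix.conjTranspose_kronecker, Matrix.conjTranspose_sub, sliceHop_conjTranspose ρ hρ,
    sliceHop'_conjTranspose ρ hρ, Finset.smul_sum]
  rw [← Finset.sum_neg_distrib]
  refine Finset.sum_congr rfl fun j _ => ?_
  have hneg : (-(sliceHop ρ U t j - sliceHop' ρ U t j)) ⊗ₖ (diracBlock j)ᴴ =
      -((sliceHop ρ U t j - sliceHop' ρ U t j) ⊗ₖ (diracBlock j)ᴴ) := by
    ext p q
    simp only [Matrix.kroneckerMap_apply, Matrix.neg_apply, neg_mul]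
  rw [← neg_sub, hneg, smul_neg, neg_neg]
  congr 1
  simp

/-- Entries of `-b_tᴴ`. [folklore] -/
theorem neg_sliceOff_conjTranspose_apply (hρ : ∀ g, ρ g ∈ Matrix.unitaryGroup (Fin N) ℂ)
    (U : GaugeConfig 4 (n + 1) G) (t : Fin (n + 1))
    (y y' : Fin 3 → ZMod (n + 1)) (a b : Fin N) (h h' : Fin 2) :
    (-(sliceOff ρ U t)ᴴ) ((y, a), h) ((y', b), h') =
      (1 / 2 : ℂ) * ∑ j : Fin 3, ((if y' = y + Pi.single j 1 then ρ (U (sliceSite t y, j.succ)) a b else 0) -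
          (if y = y' + Pi.single j 1 then ρ (U (sliceSite t y', j.succ))⁻¹ a b else 0)) * (diracBlock j)ᴴ h h' := by
  rw [neg_sliceOff_conjTranspose ρ hρ]
  simp only [Matrix.smul_apply, smul_eq_mul, Matrix.sum_apply, Matrix.kroneckerMap_apply,
    Matrix.sub_apply, sliceHop, sliceHop', Matrix.of_apply]

/-- Lower–upper entries of the Kronecker-form operator in the time-slice indexing. [folklore] -/
theorem wilsonKron_timeIndex_inr_inl (hρ : ∀ g, ρ g ∈ Matrix.unitaryGroup (Fin N) ℂ)
    (U : GaugeConfig 4 (n + 1) G) (m : ℝ)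
    (u u' : ((Fin 3 → ZMod (n + 1)) × Fin N) × Fin 2) (t s : Fin (n + 1)) :
    wilsonKron ρ diracGamma U m 1 (timeIndex n N (Sum.inr u, t)) (timeIndex n N (Sum.inl u', s)) =
      if t = s then (-(sliceOff ρ U t)ᴴ) u u' else 0 := by
  obtain ⟨⟨y, a⟩, h⟩ := u
  obtain ⟨⟨y', b⟩, h'⟩ := u'
  obtain ⟨h0m, h0p, hjm, hjp⟩ := diracGamma_lu h h'
  rw [timeIndex_inr, timeIndex_inl, wilsonKron_apply, Fin.sum_univ_succ,
    neg_sliceOff_conjTranspose_apply ρ hρ]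
  simp only [h0m, h0p, hjm, hjp, sliceSite_eq_shift_zero_iff, sliceSite_eq_shift_succ_iff, sliceSite_inj,
    (castAdd_ne_natAdd _ _).symm, mul_zero, ite_self, zero_add, Complex.ofReal_one, one_smul, and_false,
    ↓reduceIte, zero_sub]
  by_cases hts : t = s
  · subst hts
    simp only [true_and, ↓reduceIte, neg_mul_eq_mul_neg, ← Finset.sum_neg_distrib]
    congr 1
    refine Finset.sum_congr rfl fun j _ => ?_
    split_ifs <;> ring
  · have hst : ¬ s = t := fun e => hts e.symm
    simp [hts, hst]

/-- Lower–lower entries of the Kronecker-form operator in the time-slice indexing. [folklore] -/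
theorem wilsonKron_timeIndex_inr_inr (U : GaugeConfig 4 (n + 1) G) (m : ℝ)
    (u u' : ((Fin 3 → ZMod (n + 1)) × Fin N) × Fin 2) (t s : Fin (n + 1)) :
    wilsonKron ρ diracGamma U m 1 (timeIndex n N (Sum.inr u, t)) (timeIndex n N (Sum.inr u', s)) =
      (if t = s then sliceDiag ρ U m t u u' else 0) - (if s = t + 1 then sliceLink ρ U t u u' else 0) := by
  obtain ⟨⟨y, a⟩, h⟩ := u
  obtain ⟨⟨y', b⟩, h'⟩ := u'
  obtain ⟨h0m, h0p, hjm, hjp⟩ := diracGamma_ll h h'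
  have hna : (Fin.natAdd 2 h = Fin.natAdd 2 h') ↔ h = h' := (Fin.natAdd_injective _ _).eq_iff
  rw [timeIndex_inr, timeIndex_inr, wilsonKron_apply, Fin.sum_univ_succ, sliceDiag_apply, sliceLink_apply]
  simp only [h0m, h0p, hjm, hjp, sliceSite_eq_shift_zero_iff, sliceSite_eq_shift_succ_iff, sliceSite_inj,
    hna, mul_zero, ite_self, add_zero, Complex.ofReal_one, one_smul, mul_one, @eq_comm _ y' y]
  by_cases hh : h = h'
  · subst hh
    simp only [↓reduceIte, mul_one, and_true]
    by_cases hts : t = s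
    · subst hts
      simp only [↓reduceIte, true_and, ite_and]
      split_ifs <;> ring
    · have hst : ¬ s = t := fun e => hts e.symm
      simp only [hts, hst, false_and, ↓reduceIte, add_zero, Finset.sum_const_zero, zero_sub, ite_and]
      split_ifs <;> ring
  · simp [hh]

/-! ### The identification with the Wilson block matrix -/

/-- **The Wilson–Dirac operator in the Dirac-type spin basis, reindexed by time slices, is the
Wilson block matrix** of the slice blocks `a_t = d_t = sliceDiag`, `b_t = sliceOff`,
`w_t = sliceLink` (Montvay–Münster §4.2.3; Lüscher 1977 §3). [folklore] -/
theorem reindex_wilsonKron_eq_wilsonBlock (hρ : ∀ g, ρ g ∈ Matrix.unitaryGroup (Fin N) ℂ)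
    (U : GaugeConfig 4 (n + 1) G) (m : ℝ) :
    Matrix.reindex (timeIndex n N).symm (timeIndex n N).symm (wilsonKron ρ diracGamma U m 1) =
      wilsonBlock (sliceDiag ρ U m) (sliceOff ρ U) (sliceDiag ρ U m) (sliceLink ρ U) := by
  refine eq_wilsonBlock _ _ _ _ _ (fun i j t s => ?_) (fun i j t s => ?_) (fun i j t s => ?_)
    (fun i j t s => ?_) <;>
    rw [Matrix.reindex_apply, Matrix.submatrix_apply, Equiv.symm_symm]
  · exact wilsonKron_timeIndex_inl_inl ρ hρ U m i j t s
  · exact wilsonKron_timeIndex_inl_inr ρ U m i j t s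
  · exact wilsonKron_timeIndex_inr_inl ρ hρ U m i j t s
  · exact wilsonKron_timeIndex_inr_inr ρ U m i j t s

/-- **`det D_W[U]` (at `r = 1`) is the determinant of the Wilson block matrix of the slice
blocks.** [folklore] -/
theorem det_wilsonDirac_eq_det_wilsonBlock (hρ : ∀ g, ρ g ∈ Matrix.unitaryGroup (Fin N) ℂ)
    (U : GaugeConfig 4 (n + 1) G) (m : ℝ) :
    (wilsonDirac ρ U m 1).det =
      (wilsonBlock (sliceDiag ρ U m) (sliceOff ρ U) (sliceDiag ρ U m) (sliceLink ρ U)).det := by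
  rw [det_wilsonDirac_eq_det_wilsonKron_diracGamma, ← reindex_wilsonKron_eq_wilsonBlock ρ hρ,
    Matrix.det_reindex_self]

/-! ### Algebraic properties of the slice blocks -/

omit [Group G] in
/-- Entries of the identity matrix on a product index. [folklore] -/
private theorem one_apply_prod {κ : Type*} [DecidableEq κ] (y y' : κ) (a b : Fin N) :
    (1 : Matrix (κ × Fin N) (κ × Fin N) ℂ) (y, a) (y', b) = if y = y' then (1 : Matrix (Fin N) (Fin N) ℂ) a b else 0 := by
  simp only [Matrix.one_apply, Prod.mk.injEq]
  by_cases h : y = y' <;> simp [h]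

/-- The forward and backward spatial hoppings are inverse to each other. [folklore] -/
theorem sliceHop_mul_sliceHop' (U : GaugeConfig 4 (n + 1) G) (t : Fin (n + 1)) (j : Fin 3) :
    sliceHop ρ U t j * sliceHop' ρ U t j = 1 := by
  ext ⟨y, a⟩ ⟨y', b⟩
  rw [Matrix.mul_apply, Fintype.sum_prod_type, one_apply_prod]
  simp only [sliceHop, sliceHop', Matrix.of_apply, ite_mul, zero_mul, Finset.sum_ite_irrel,
    Finset.sum_const_zero, Finset.sum_ite_eq', Finset.mem_univ, ↓reduceIte, mul_ite, mul_zero,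
    add_left_inj]
  by_cases h : y = y'
  · subst h
    simp only [↓reduceIte]
    rw [← Matrix.mul_apply, ← map_mul, mul_inv_cancel, map_one]
  · simp [h, Ne.symm h]

/-- The backward and forward spatial hoppings are inverse to each other. [folklore] -/
theorem sliceHop'_mul_sliceHop [NeZero N] (U : GaugeConfig 4 (n + 1) G) (t : Fin (n + 1)) (j : Fin 3) :
    sliceHop' ρ U t j * sliceHop ρ U t j = 1 :=
  mul_eq_one_comm.mp (sliceHop_mul_sliceHop' ρ U t j)

/-- **The spatial block as a manifestly positive combination**:
`a_t = (m + 1)·1 + ½ Σ_j (1 - K_j)ᴴ (1 - K_j)` with the unitary hoppings `K_j = H_j ⊗ 1₂`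
(`1 - ½(K + Kᴴ) = ½ (1 - K)ᴴ(1 - K)` for unitary `K`). [folklore] -/
theorem sliceDiag_eq_sum_conjTranspose_mul_self (hρ : ∀ g, ρ g ∈ Matrix.unitaryGroup (Fin N) ℂ)
    [NeZero N] (U : GaugeConfig 4 (n + 1) G) (m : ℝ) (t : Fin (n + 1)) :
    sliceDiag ρ U m t = ((m + 1 : ℝ) : ℂ) • (1 : Matrix _ _ ℂ) +
      (1 / 2 : ℂ) • ∑ j : Fin 3, ((1 - sliceHop ρ U t j ⊗ₖ (1 : Matrix (Fin 2) (Fin 2) ℂ))ᴴ *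
        (1 - sliceHop ρ U t j ⊗ₖ (1 : Matrix (Fin 2) (Fin 2) ℂ))) := by
  have hsq : ∀ j : Fin 3, (1 - sliceHop ρ U t j ⊗ₖ (1 : Matrix (Fin 2) (Fin 2) ℂ))ᴴ *
      (1 - sliceHop ρ U t j ⊗ₖ (1 : Matrix (Fin 2) (Fin 2) ℂ)) =
      (2 : ℂ) • (1 : Matrix _ _ ℂ) - (sliceHop ρ U t j + sliceHop' ρ U t j) ⊗ₖ (1 : Matrix (Fin 2) (Fin 2) ℂ) := by
    intro j
    rw [Matrix.conjTranspose_sub, Matrix.conjTranspose_one, Matrix.conjTranspose_kronecker,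
      Matrix.conjTranspose_one, sliceHop_conjTranspose ρ hρ, Matrix.sub_mul, Matrix.mul_sub,
      Matrix.mul_sub, Matrix.one_mul, Matrix.one_mul, Matrix.mul_one, ← Matrix.mul_kronecker_mul,
      sliceHop'_mul_sliceHop, Matrix.mul_one, Matrix.one_kronecker_one, Matrix.add_kronecker, two_smul]
    abel
  simp only [hsq, Finset.sum_sub_distrib, Finset.sum_const, Finset.card_univ, Fintype.card_fin,
    smul_sub, sliceDiag, Complex.ofReal_add, Complex.ofReal_one, Complex.ofReal_ofNat]
  module

/-- **The spatial block is Hermitian positive definite for `m > -1`** — the site-reflection-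
positivity range `|κ| < 1/6` of the hopping parameter `κ = 1/(2m+8)` (Montvay–Münster (4.111)). [cite: MontvayMunster1994, §4.2.3 (4.111)] -/
theorem posDef_sliceDiag (hρ : ∀ g, ρ g ∈ Matrix.unitaryGroup (Fin N) ℂ) [NeZero N]
    (U : GaugeConfig 4 (n + 1) G) {m : ℝ} (hm : -1 < m) (t : Fin (n + 1)) :
    (sliceDiag ρ U m t).PosDef := by
  rw [sliceDiag_eq_sum_conjTranspose_mul_self ρ hρ]
  refine Matrix.PosDef.add_posSemidef ?_ ?_
  · have h1 : (0 : ℂ) < ((m + 1 : ℝ) : ℂ) := Complex.zero_lt_real.2 (by linarith)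
    exact Matrix.PosDef.one.smul h1
  · refine Matrix.PosSemidef.smul (Matrix.posSemidef_sum _ fun j _ =>
      Matrix.posSemidef_conjTranspose_mul_self _) ?_
    rw [show (1 / 2 : ℂ) = ((1 / 2 : ℝ) : ℂ) by push_cast; ring]
    exact Complex.zero_le_real.2 (by norm_num)

/-- The spatial block is Hermitian. [folklore] -/
theorem isHermitian_sliceDiag (hρ : ∀ g, ρ g ∈ Matrix.unitaryGroup (Fin N) ℂ) [NeZero N]
    (U : GaugeConfig 4 (n + 1) G) {m : ℝ} (hm : -1 < m) (t : Fin (n + 1)) :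
    (sliceDiag ρ U m t).IsHermitian :=
  (posDef_sliceDiag ρ hρ U hm t).isHermitian

/-- The temporal link block is unitary. [folklore] -/
theorem timeLink_mul_conjTranspose (hρ : ∀ g, ρ g ∈ Matrix.unitaryGroup (Fin N) ℂ)
    (U : GaugeConfig 4 (n + 1) G) (t : Fin (n + 1)) :
    timeLink ρ U t * (timeLink ρ U t)ᴴ = 1 := by
  ext ⟨y, a⟩ ⟨y', b⟩
  rw [Matrix.mul_apply, Fintype.sum_prod_type, one_apply_prod]
  simp only [timeLink, Matrix.conjTranspose_apply, Matrix.of_apply, ite_mul, zero_mul,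
    Finset.sum_ite_irrel, Finset.sum_const_zero, Finset.sum_ite_eq, Finset.mem_univ, ↓reduceIte]
  by_cases h : y = y'
  · subst h
    simp only [↓reduceIte]
    have hu : ρ (U (sliceSite t y, 0)) * star (ρ (U (sliceSite t y, 0))) = 1 :=
      Matrix.mem_unitaryGroup_iff.1 (hρ _)
    rw [← hu, Matrix.mul_apply]
    rfl
  · simp [h, Ne.symm h]

/-- **The temporal block `w_t` is unitary.** [folklore] -/
theorem sliceLink_mul_conjTranspose (hρ : ∀ g, ρ g ∈ Matrix.unitaryGroup (Fin N) ℂ)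
    (U : GaugeConfig 4 (n + 1) G) (t : Fin (n + 1)) :
    sliceLink ρ U t * (sliceLink ρ U t)ᴴ = 1 := by
  rw [sliceLink, Matrix.conjTranspose_kronecker, Matrix.conjTranspose_one, ← Matrix.mul_kronecker_mul,
    timeLink_mul_conjTranspose ρ hρ, Matrix.mul_one, Matrix.one_kronecker_one]

end SliceBlocks

end Literature.MathematicalPhysics.QuantumLattice

end
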